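import Summits.ResolutionOfSingularities.ResolutionOfSingularities.Theorems.EquisingularLiftCampaignW45bULT
import Literature.AlgebraicGeometry.Resolution.OrderSemicontinuity
import Mathlib.AlgebraicGeometry.Noetherian
import Mathlib.Topology.LocallyClosed
import HarnessLib

/-!
# [OURS · L1 W4.5(b)] ULT horizontality — the TOPOLOGICAL BRIDGE between «x′ ∈ closure (supp C ∖ special fibre)»
# and «some point of supp C off the special fibre specialises to x′»
# (cell res-hironaka, LADDER-RESOLUTION rung L; slot W4.5(b), crux EL♮ `EquisingularLiftNat`
# stmt-ResolutionOfSingularities-20038; `--supports stmt-ResolutionOfSingularities-20038 --as helper`)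

Everything here is OURS campaign plumbing (pure topology + one scheme corollary); nothing is a statement of Hironaka's
manuscript and no `Literature.…` named fact is used. ROUTE-INDEPENDENT (imports Theorems files, the Resolution library and
Mathlib only; never a `Theses/…` file). Object (2) of res-L1-type-o1's NAMING 2026-08-27T05:33:25Z.

## Why

res-L1-type-o1's `EquisingularLift.ULT p` / `ULTAt …` (`Theorems/EquisingularLiftCampaignW45bULT.lean`, p499585 → v2
p501162) phrases HORIZONTALITY of the touching centre `C` at `x′` as
«`∃ c ∈ C.support, c ∉ (σ ≫ q)⁻¹{s₀} ∧ c ⤳ x′`», while res-L1-w45b-lead-1's V-pack / FirstTouch v2 (STATUS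
2026-08-27T05:28:38Z, clause (H1)) OUTPUTS «`x′ ∈ closure (C.support ∖ (σ ≫ q)⁻¹{s₀})`». On a locally Noetherian
scheme the two are EQUIVALENT, because `C.support ∖ F` is locally closed (closed minus closed) and in a Noetherian sober
space every point of the closure of a locally closed set is a specialisation of a point OF the set.

## What is proved

* `EquisingularLift.exists_mem_specializes_of_mem_closure` — topological: `α` Noetherian and quasi-sober, `S ⊆ α`
  locally closed, `x ∈ closure S` ⇒ `∃ c ∈ S, c ⤳ x` (from the tree's
  `Resolution.exists_specializes_mem_closure_inter`: some `ξ ⤳ x` lies in `closure (S ∩ closure {ξ})`; with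
  `S = U ∩ Z`, a point `s ∈ S ∩ closure {ξ}` exists, `s ∈ U` open forces `ξ ∈ U`, and `ξ ∈ Z` since `Z` is closed
  and contains `S ∩ closure {ξ}`; so `ξ ∈ S`).
* `EquisingularLift.mem_closure_of_mem_specializes` — the converse, in any topological space.
* `EquisingularLift.mem_closure_iff_exists_mem_specializes` — the `↔` on a Noetherian quasi-sober space.
* `EquisingularLift.Scheme.exists_mem_specializes_of_mem_closure` — the same on a LOCALLY Noetherian scheme (through an
  affine open neighbourhood of `x`, which is a Noetherian sober space), and the `↔`
  `EquisingularLift.Scheme.mem_closure_iff_exists_mem_specializes`.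
* `EquisingularLift.mem_closure_support_diff_iff` — the ULT-vocabulary corollary: for a locally Noetherian scheme `X`,
  an ideal sheaf `C` on `X`, any CLOSED `F ⊆ X` (e.g. the special fibre `(σ ≫ q)⁻¹{s₀}`, closed as the preimage of
  the closed point of `Spec O`) and `x′ : X`:
  `x′ ∈ closure ((C.support : Set X) \ F) ↔ ∃ c ∈ (C.support : Set X), c ∉ F ∧ c ⤳ x′`;
  with the two directions `EquisingularLift.exists_horizontal_of_mem_closure_support_diff` ((H1) ⇒ ULT clause) and
  `EquisingularLift.mem_closure_support_diff_of_horizontal` (ULT clause ⇒ (H1), any scheme); and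
  `EquisingularLift.isClosed_preimage_closedPoint` records that such special fibres are closed.

AI-written; no expert review; AI review is weaker than expert review. References (context only): the tree's
`Literature/AlgebraicGeometry/Resolution/OrderSemicontinuity.lean` (the Noetherian-sober closure lemma); Stacks Project
Tag 0903 (specialisations in sober Noetherian spaces) — folklore.
-/

noncomputable section

set_option linter.dupNamespace false -- mandated namespace of this single-conjunct summit

open CategoryTheory AlgebraicGeometry TopologicalSpace Topology
open Literature.AlgebraicGeometry.Resolution

namespace Summit.ResolutionOfSingularities.ResolutionOfSingularities.Theorems

namespace EquisingularLift

/-! ## §1 Pure topology -/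

/-- [OURS · W4.5(b) plumbing] In a Noetherian quasi-sober space, every point of the closure of a LOCALLY CLOSED set `S`
is a specialisation of a point of `S`. (For arbitrary `S` this fails: an infinite set of closed points of a curve has
the generic point in its closure but specialises to nothing new.) [folklore] -/
theorem exists_mem_specializes_of_mem_closure {α : Type*} [TopologicalSpace α] [NoetherianSpace α] [QuasiSober α]
    {S : Set α} (hS : IsLocallyClosed S) {x : α} (hx : x ∈ closure S) : ∃ c ∈ S, c ⤳ x := by
  obtain ⟨ξ, hξx, hξ⟩ := exists_specializes_mem_closure_inter S hx
  obtain ⟨U, Z, hU, hZ, rfl⟩ := hS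
  refine ⟨ξ, ⟨?_, ?_⟩, hξx⟩
  · -- some point of `S ∩ closure {ξ}` exists; it lies in the open `U`, hence so does its generization `ξ`
    have hne : (U ∩ Z ∩ closure {ξ}).Nonempty := by
      by_contra h
      rw [Set.not_nonempty_iff_eq_empty] at h
      rw [h, closure_empty] at hξ
      exact hξ
    obtain ⟨s, ⟨hsU, -⟩, hsξ⟩ := hne
    have hξs : ξ ⤳ s := specializes_iff_mem_closure.mpr hsξ
    exact hξs.mem_open hU hsU
  · -- `Z` is closed and contains `S ∩ closure {ξ}`, hence its closure, hence `ξ`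
    have hsub : U ∩ Z ∩ closure {ξ} ⊆ Z := fun y hy => hy.1.2
    exact hZ.closure_subset_iff.mpr hsub hξ

/-- [OURS · W4.5(b) plumbing] The converse, in any topological space: a specialisation of a point of `S` lies in the
closure of `S`. [folklore] -/
theorem mem_closure_of_mem_specializes {α : Type*} [TopologicalSpace α] {S : Set α} {x c : α} (hc : c ∈ S)
    (hcx : c ⤳ x) : x ∈ closure S :=
  closure_mono (Set.singleton_subset_iff.mpr hc) (specializes_iff_mem_closure.mp hcx)

/-- [OURS · W4.5(b) plumbing] On a Noetherian quasi-sober space, for a locally closed `S`: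
`x ∈ closure S ↔ ∃ c ∈ S, c ⤳ x`. [folklore] -/
theorem mem_closure_iff_exists_mem_specializes {α : Type*} [TopologicalSpace α] [NoetherianSpace α] [QuasiSober α]
    {S : Set α} (hS : IsLocallyClosed S) (x : α) : x ∈ closure S ↔ ∃ c ∈ S, c ⤳ x :=
  ⟨fun hx => exists_mem_specializes_of_mem_closure hS hx, fun ⟨_, hc, hcx⟩ => mem_closure_of_mem_specializes hc hcx⟩

/-! ## §2 On locally Noetherian schemes -/

/-- [OURS · W4.5(b) plumbing] On a LOCALLY Noetherian scheme, every point of the closure of a locally closed set `S` is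
a specialisation of a point of `S` (work in an affine open neighbourhood of the point, a Noetherian sober space, using
that open embeddings pull closures back to closures). [folklore] -/
theorem Scheme.exists_mem_specializes_of_mem_closure {X : Scheme} [IsLocallyNoetherian X] {S : Set X}
    (hS : IsLocallyClosed S) {x : X} (hx : x ∈ closure S) : ∃ c ∈ S, c ⤳ x := by
  obtain ⟨U, hU, hxU, -⟩ :=
    exists_isAffineOpen_mem_and_subset (X := X) (x := x) (U := ⊤) (Opens.mem_top x)
  haveI : IsNoetherianRing Γ(X, U) := IsLocallyNoetherian.component_noetherian ⟨U, hU⟩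
  -- the affine open `U`, as a scheme, is a Noetherian sober space
  haveI : NoetherianSpace (U : Scheme) := noetherianSpace_of_isAffineOpen U hU
  have hf : IsOpenEmbedding (U.ι : (U : Scheme) ⟶ X) := U.ι.isOpenEmbedding
  -- the point `x`, seen in `U`, lies in the closure of `U.ι ⁻¹ S` taken inside `U`
  let v : (U : Scheme) := ⟨x, hxU⟩
  have hv : U.ι v = x := rfl
  have hx' : v ∈ closure ((fun u : (U : Scheme) => U.ι u) ⁻¹' S) :=
    hf.isOpenMap.preimage_closure_subset_closure_preimage
      (show v ∈ (fun u : (U : Scheme) => U.ι u) ⁻¹' closure S by rw [Set.mem_preimage, hv]; exact hx)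
  obtain ⟨c, hcS, hcv⟩ := EquisingularLift.exists_mem_specializes_of_mem_closure
    (hS.preimage U.ι.continuous) hx'
  exact ⟨U.ι c, hcS, hv ▸ hcv.map U.ι.continuous⟩

/-- [OURS · W4.5(b) plumbing] On a locally Noetherian scheme, for a locally closed `S`:
`x ∈ closure S ↔ ∃ c ∈ S, c ⤳ x`. [folklore] -/
theorem Scheme.mem_closure_iff_exists_mem_specializes {X : Scheme} [IsLocallyNoetherian X] {S : Set X}
    (hS : IsLocallyClosed S) (x : X) : x ∈ closure S ↔ ∃ c ∈ S, c ⤳ x :=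
  ⟨fun hx => Scheme.exists_mem_specializes_of_mem_closure hS hx,
    fun ⟨_, hc, hcx⟩ => mem_closure_of_mem_specializes hc hcx⟩

/-! ## §3 The ULT vocabulary -/

/-- [OURS · W4.5(b) plumbing] Special fibres are closed: for any morphism `g : X ⟶ Spec O` with `O` local, the preimage
of the closed point of `Spec O` is closed (the closed point of a local ring's spectrum is a closed point). [folklore] -/
theorem isClosed_preimage_closedPoint {O : Type} [CommRing O] [IsLocalRing O] {X : Scheme.{0}}
    (g : X ⟶ Spec (CommRingCat.of O)) : IsClosed ((g : X ⟶ Spec (CommRingCat.of O)) ⁻¹' {IsLocalRing.closedPoint O}) :=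
  (IsLocalRing.isClosed_singleton_closedPoint (R := O)).preimage g.base.hom.continuous

/-- [OURS · L1 W4.5(b)] replaces the role of NOTHING in the manuscript; NOT a statement of the manuscript.
**ULT horizontality, the two phrasings agree.** On a locally Noetherian scheme `X`, for an ideal sheaf `C`, a CLOSED
subset `F ⊆ X` (in ULT: the special fibre `(σ ≫ q)⁻¹{s₀}`, closed by `isClosed_preimage_closedPoint`) and a point
`x′`: `x′ ∈ closure (C.support ∖ F)` (res-L1-w45b-lead-1's (H1)) iff some `c ∈ C.support` with `c ∉ F` specialises to
`x′` (the horizontality conjunct of res-L1-type-o1's `ULT` / `ULTAt`, p501162). `C.support ∖ F` is locally closed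
(closed minus closed), so §2 applies. [folklore] -/
theorem mem_closure_support_diff_iff {X : Scheme} [IsLocallyNoetherian X] (C : X.IdealSheafData) {F : Set X}
    (hF : IsClosed F) (x' : X) :
    x' ∈ closure ((C.support : Set X) \ F) ↔ ∃ c : X, c ∈ (C.support : Set X) ∧ c ∉ F ∧ c ⤳ x' := by
  have hlc : IsLocallyClosed ((C.support : Set X) \ F) :=
    ⟨Fᶜ, C.support, hF.isOpen_compl, C.support.isClosed, by ext y; simp [and_comm]⟩
  rw [Scheme.mem_closure_iff_exists_mem_specializes hlc]
  constructor
  · rintro ⟨c, ⟨hc, hcF⟩, hcx⟩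
    exact ⟨c, hc, hcF, hcx⟩
  · rintro ⟨c, hc, hcF, hcx⟩
    exact ⟨c, ⟨hc, hcF⟩, hcx⟩

/-- [OURS · L1 W4.5(b)] replaces the role of NOTHING in the manuscript; NOT a statement of the manuscript.
**(H1) ⇒ the ULT horizontality conjunct**, the direction FirstTouch v2 feeds into `ULT`: from
`x′ ∈ closure (C.support ∖ F)` get `c ∈ C.support`, `c ∉ F`, `c ⤳ x′`. [folklore] -/
theorem exists_horizontal_of_mem_closure_support_diff {X : Scheme} [IsLocallyNoetherian X] (C : X.IdealSheafData)
    {F : Set X} (hF : IsClosed F) {x' : X} (hx' : x' ∈ closure ((C.support : Set X) \ F)) :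
    ∃ c : X, c ∈ (C.support : Set X) ∧ c ∉ F ∧ c ⤳ x' :=
  (mem_closure_support_diff_iff C hF x').mp hx'

/-- [OURS · L1 W4.5(b)] replaces the role of NOTHING in the manuscript; NOT a statement of the manuscript.
**The ULT horizontality conjunct ⇒ (H1)** (any scheme, no Noetherian hypothesis, `F` arbitrary). [folklore] -/
theorem mem_closure_support_diff_of_horizontal {X : Scheme} (C : X.IdealSheafData) {F : Set X} {x' c : X}
    (hc : c ∈ (C.support : Set X)) (hcF : c ∉ F) (hcx : c ⤳ x') : x' ∈ closure ((C.support : Set X) \ F) :=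
  mem_closure_of_mem_specializes ⟨hc, hcF⟩ hcx

end EquisingularLift

end Summit.ResolutionOfSingularities.ResolutionOfSingularities.Theorems

end
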